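import Mathlib
import Literature.Computability.AlgebraicComplexity.GroupTheoreticMatMul
import Summits.MatrixMultiplication.MatrixMultiplication.Theorems.AbelianSTPPCensusTargets
import Summits.MatrixMultiplication.MatrixMultiplication.Theorems.AbelianSTPPSieve
import Summits.MatrixMultiplication.MatrixMultiplication.Theorems.AbelianSTPPCensusSieveRulesReversal
import Summits.MatrixMultiplication.MatrixMultiplication.Theorems.AbelianSTPPCensusTEResiduals
import Summits.MatrixMultiplication.MatrixMultiplication.Theorems.AbelianSTPPCensusGlue

/-!
# Abelian STPP census, rung F-M1: the leaf `NoAbelianSTPPHost_250_127` modulo the arithmetic shape exclusion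

Support file for route `MatrixMultiplication/GroupTheoreticSTPP`, negative crux
`stmt-MatrixMultiplication-0596` (`CAbelianObstructionNeg`), finite-range evidence; cell mm-stpp, rung F-M1
(D-0059/D-0061), draft route `AbelianSTPPCensus` (HOME/mm-stpp-plan/route/).

`noAbelianSTPPHost_250_127_of_shapeExclusionTE`: the rung leaf «no STPP family in any finite abelian group
of order `≤ 127` beats `τ = 5/2`» follows from the single arithmetic statement `ShapeExclusionTE` of the
draft route (verbatim as hypothesis: every shape list with `≥ 2` members that passes the sieve system vM at
an order `M ≤ 127` and beats `5/2` there contains one of the nine residual sub-multisets) — the other four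
route items are theorems: sieve soundness (`AbelianTECensus.sieveSound`), the residual cruxes
(`teOrder125`, `teResidualSmall`, `teResidualLarge`, all by the Kneser-free second-moment certificate) and
the glue (`noAbelianSTPPHost_250_127_of_cruxes`).

WHAT THIS IS NOT: no `ω` statement; the hypothesis is the certificate replay of the cell's shape sieve
(lineage A′ kit j244071 + lineage B; ≈ 2.6·10⁶ DFS nodes), which is NOT a kernel object yet.
-/

-- single-conjunct summit: the mandated namespace repeats `MatrixMultiplication`.
set_option linter.dupNamespace false

namespace Summit.MatrixMultiplication.MatrixMultiplication.Theorems

namespace AbelianTECensus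

open Finset Literature.Computability.AlgebraicComplexity

/-- **The rung leaf modulo the arithmetic shape exclusion.** If every vM-admissible shape list with at least
two members that beats `τ = 5/2` at an order `M ≤ 127` contains one of the nine residual sub-multisets
(the draft route's `ShapeExclusionTE`, verbatim), then `NoAbelianSTPPHost_250_127`. [original] -/
theorem noAbelianSTPPHost_250_127_of_shapeExclusionTE
    (h₁ : ∀ (N M : ℕ) (a b c : Fin N → ℕ), 2 ≤ N → M ≤ 127 → SieveAdmissible M a b c →
      Beats (5 / 2) M a b c →
      (M = 111 ∧ HasSubShapes a b c [(4,4,4),(4,4,4),(4,4,4),(3,3,3)]) ∨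
      ((M = 120 ∨ M = 121) ∧ (HasSubShapes a b c [(4,4,4),(4,4,4),(4,4,4),(4,4,3)] ∨
          HasSubShapes a b c [(4,4,4),(4,4,4),(4,4,4),(4,3,4)] ∨
          HasSubShapes a b c [(4,4,4),(4,4,4),(4,4,4),(3,4,4)])) ∨
      (M = 124 ∧ (HasSubShapes a b c [(5,4,3),(3,4,5),(4,4,4),(4,4,4)] ∨
          HasSubShapes a b c [(5,3,4),(3,5,4),(4,4,4),(4,4,4)] ∨
          HasSubShapes a b c [(4,5,3),(4,3,5),(4,4,4),(4,4,4)] ∨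
          HasSubShapes a b c [(4,4,4),(4,4,4),(4,4,4),(4,4,4)])) ∨
      (M = 125 ∧ (HasSubShapes a b c [(4,4,4),(4,4,4),(4,4,4),(4,4,4)] ∨
          HasSubShapes a b c [(5,5,3),(5,3,5),(3,5,5),(3,3,3)])) ∨
      ((M = 126 ∨ M = 127) ∧ HasSubShapes a b c [(4,4,4),(4,4,4),(4,4,4),(4,4,4)])) :
    NoAbelianSTPPHost_250_127 :=
  noAbelianSTPPHost_250_127_of_cruxes sieveSound h₁ teOrder125 teResidualSmall teResidualLarge

end AbelianTECensus

end Summit.MatrixMultiplication.MatrixMultiplication.Theorems
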